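import Summits.HodgeConjecture.HodgeConjecture.Theorems.HLiu418E2Density
import Summits.HodgeConjecture.HodgeConjecture.Theorems.HLiu418E2Bootstrap
import Literature.NumberTheory.Automorphic.UnitaryCurveCohCotangentFormsConjRep
import HarnessLib

/-!
# Crux `HLiu418`, K-lane E₂ — the HEADS: the letters E₂-hol / E₂-antihol (`UnitaryCurveForms.cohIsotypicLine₂_hol / _antihol`, bodies verbatim)
# FROM the two remaining rank-2 cuts S2⁺₂ (archimedean orthogonality) and S3₂ (admissibility); S1 and S2β₂ DISCHARGED by name

Cell `hodgecm-mathlib`, FLOOR 0, programme P5 (`F0_AlbCm`); crux item `stmt-HodgeConjecture-24832` (`HCCMUnconditional.HLiu418`); seat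
F0P5-p02 (g2), `--supports stmt-HodgeConjecture-24832` (helper).  THEOREMS ONLY — no definition, no instance, no notation, no `sorry`; the rank-2
cut statements `ArchOrthHolType₂` / `DensityType₂` / `AdmissibleOfHolValuedType₂` (HOME draft `F0/P5/p02/KE2/HLiu418E2Cuts…`, bodies below TOKEN
FOR TOKEN) enter as HYPOTHESES `hα` / `hβ` / `hadm` — stub statements of a K-lane, not printed citations.  The conclusions are the BODIES of the
letters ★ `UnitaryCurveForms.cohIsotypicLine₂_hol / _antihol` (★ p794463 :149 / :176) verbatim, NOT the names, so that the gate books NO discharge: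
E₂ stays a declared named fact until `hα` and `hadm` are kernel theorems (HONEST LABEL).  Rank-2 twin of §4–§5 of the rank-3 line
`Cruxes/H413/Lines/F0_P2aCohIsotypicLine` (which closed ★ `CotangentForms.cohIsotypicLine_hol`):
* §1 `orthVanish₂_hol`: orthogonality-vanishing for `A = holCotForms₂ … 𝔣` from S2⁺₂ (`hα`) and S2β₂ (`hβ`);
* §2 HEADS: `cohIsotypicLine₂_hol_of_three_cuts (hα) (hβ) (hadm)` (the by-name composition shape of a registered sub-line over its own three
  stubs), **`cohIsotypicLine₂_hol_of_cuts (hα) (hadm)`** with S2β₂ DISCHARGED by ★ `E2Density.density₂_holds`, and — by A-p06's conjugation transport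
  ★ `UnitaryCurveForms.cohIsotypicLine₂_antihol_of_hol` (p798131) — **`cohIsotypicLine₂_antihol_of_cuts (hα) (hadm)`**.
So the P5 named facts E₂-hol / E₂-antihol (hypothesis `hEh` of ★ `Theorems/F0AlbCmS1BettiHolds`, via ★ `HLiu418S1MultOneFormsOfLetters`) are
reduced to EXACTLY two rank-2 analytic statements: S2⁺₂ (the `U(1,1)` archimedean core) and S3₂ (finite-dimensionality of level-`K` cone forms).

HONEST LABEL: HC_CM is proved only modulo the 7 printed citations until rung 0 closes; this file discharges none of them.

## References
* [Liu2021] Y. Liu, Camb. J. Math. 9 (2021), App. D §D.1 (after Lem. D.1), Lem. D.2 (2), §D.3.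
* [BorelWallach2000] A. Borel, N. Wallach, 2nd ed. (2000), VI 4.11, VII 2.10, 3.2.  [BorelJacquet1979] Corvallis PSPM 33.1, §4.2, §4.6.
-/

set_option autoImplicit false
-- the mandated namespace has the single-problem summit's repeated segment (`HodgeConjecture.HodgeConjecture`)
set_option linter.dupNamespace false

noncomputable section

open MeasureTheory NumberField NumberField.InfinitePlace
open scoped InnerProductSpace ENNReal ComplexOrder Matrix

namespace Summit.HodgeConjecture.HodgeConjecture.Cruxes.HLiu418.E2OfCuts

open Literature.NumberTheory.Automorphic Literature.NumberTheory.Automorphic.UnitaryGroup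
open Literature.NumberTheory.Automorphic.UnitaryGroup.CotangentForms (toQuotFun)
open Literature.NumberTheory.Automorphic.UnitaryCurveForms
open Summit.HodgeConjecture.HodgeConjecture.Cruxes.HLiu418.E2Density
open Summit.HodgeConjecture.HodgeConjecture.Cruxes.HLiu418.E2Bootstrap

/-! ## §1–§2 The CM frame of the letter: `OrthVanish (hol)` from S2⁺₂ + S2β₂, and THE HEADS (letter bodies verbatim) -/

section Heads

/- The two OPEN rank-2 cut statements, as hypotheses (bodies = `E2Cuts.ArchOrthHolType₂` / `AdmissibleOfHolValuedType₂` of the HOME draft, verbatim). -/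
variable
  (hα : ∀ (L : Type) [Field L] [NumberField L] [IsCMField L] (ι : L →+* ℂ) (H : Matrix (Fin 2) (Fin 2) L)
    (dV : Fin 2 → L) (_hdV : ∀ i, IsCMField.complexConj L (dV i) = dV i) (_hdV0 : ∀ i, dV i ≠ 0)
    (t : L) (_ht : t ≠ 0) (g : GL (Fin 2) L),
    formCongr ((IsCMField.complexConj L : L ≃ₐ[↥(maximalRealSubfield L)] L) : L →+* L) g (t • H) = Matrix.diagonal dV →
    (∃ T : GL (Fin 2) ℂ, formCongr (starRingEnd ℂ) T ((Matrix.diagonal dV).map ι) = Matrix.diagonal ![(1 : ℂ), -1]) →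
    (∀ τ' : L →+* ℂ, InfinitePlace.mk τ' ≠ InfinitePlace.mk ι → ((Matrix.diagonal dV).map τ').PosDef) →
    4 ≤ Module.finrank ℚ L →
    ∀ (𝔣 : ConeFrame L H (cmPlace L ι))
      (μ : Measure (adelicGroupData (↥(maximalRealSubfield L)) L (IsCMField.complexConj L) 2 H).automorphicQuotient)
      [(adelicGroupData (↥(maximalRealSubfield L)) L (IsCMField.complexConj L) 2 H).IsAutomorphicMeasure μ]
      (f f₃ : (adelicGroupData (↥(maximalRealSubfield L)) L (IsCMField.complexConj L) 2 H).Adelic → ℂ),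
      f ∈ holCotForms₂ (↥(maximalRealSubfield L)) L (IsCMField.complexConj L) H (IsCMField.complexConj_ne_one L)
          (UnitaryGroup.complexConj_smul_infinitePlace L) (cmPlace L ι) 𝔣 →
      f₃ ∈ holCotForms₂ (↥(maximalRealSubfield L)) L (IsCMField.complexConj L) H (IsCMField.complexConj_ne_one L)
          (UnitaryGroup.complexConj_smul_infinitePlace L) (cmPlace L ι) 𝔣 →
    ∀ (hf : MemLp (toQuotFun (adelicGroupData (↥(maximalRealSubfield L)) L (IsCMField.complexConj L) 2 H) f) 2 μ)
      (h₃ : MemLp (toQuotFun (adelicGroupData (↥(maximalRealSubfield L)) L (IsCMField.complexConj L) 2 H) f₃) 2 μ),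
    ⟪MemLp.toLp (toQuotFun (adelicGroupData (↥(maximalRealSubfield L)) L (IsCMField.complexConj L) 2 H) f) hf,
      MemLp.toLp (toQuotFun (adelicGroupData (↥(maximalRealSubfield L)) L (IsCMField.complexConj L) 2 H) f₃) h₃⟫_ℂ = 0 →
    ∀ u : archLocal L 2 H (cmPlace L ι),
      ⟪(adelicGroupData (↥(maximalRealSubfield L)) L (IsCMField.complexConj L) 2 H).rightRegular μ
          (adelicSingle (↥(maximalRealSubfield L)) L (IsCMField.complexConj L) 2 H (IsCMField.complexConj_ne_one L)
            (UnitaryGroup.complexConj_smul_infinitePlace L) (cmPlace L ι) u)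
          (MemLp.toLp (toQuotFun (adelicGroupData (↥(maximalRealSubfield L)) L (IsCMField.complexConj L) 2 H) f) hf),
        MemLp.toLp (toQuotFun (adelicGroupData (↥(maximalRealSubfield L)) L (IsCMField.complexConj L) 2 H) f₃) h₃⟫_ℂ = 0)
  (hβ : ∀ (L : Type) [Field L] [NumberField L] [IsCMField L] (ι : L →+* ℂ) (H : Matrix (Fin 2) (Fin 2) L)
    (dV : Fin 2 → L) (_hdV : ∀ i, IsCMField.complexConj L (dV i) = dV i) (_hdV0 : ∀ i, dV i ≠ 0)
    (t : L) (_ht : t ≠ 0) (g : GL (Fin 2) L),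
    formCongr ((IsCMField.complexConj L : L ≃ₐ[↥(maximalRealSubfield L)] L) : L →+* L) g (t • H) = Matrix.diagonal dV →
    (∃ T : GL (Fin 2) ℂ, formCongr (starRingEnd ℂ) T ((Matrix.diagonal dV).map ι) = Matrix.diagonal ![(1 : ℂ), -1]) →
    (∀ τ' : L →+* ℂ, InfinitePlace.mk τ' ≠ InfinitePlace.mk ι → ((Matrix.diagonal dV).map τ').PosDef) →
    4 ≤ Module.finrank ℚ L →
    ∀ (𝔣 : ConeFrame L H (cmPlace L ι))
      (μ : Measure (adelicGroupData (↥(maximalRealSubfield L)) L (IsCMField.complexConj L) 2 H).automorphicQuotient)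
      [(adelicGroupData (↥(maximalRealSubfield L)) L (IsCMField.complexConj L) 2 H).IsAutomorphicMeasure μ]
      (P : DiscreteAutomorphicRep (adelicGroupData (↥(maximalRealSubfield L)) L (IsCMField.complexConj L) 2 H) μ)
      (N : Submodule ℂ ((adelicGroupData (↥(maximalRealSubfield L)) L (IsCMField.complexConj L) 2 H).Adelic → ℂ)),
      N ≤ holCotForms₂ (↥(maximalRealSubfield L)) L (IsCMField.complexConj L) H (IsCMField.complexConj_ne_one L)
          (UnitaryGroup.complexConj_smul_infinitePlace L) (cmPlace L ι) 𝔣 →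
      (∀ f ∈ N, P.ContainsFun f) →
      (∀ (k : finAdelic (↥(maximalRealSubfield L)) L (IsCMField.complexConj L) 2 H), ∀ f ∈ N,
          rightRep₂ (↥(maximalRealSubfield L)) L (IsCMField.complexConj L) H k f ∈ N) →
      N ≠ ⊥ →
    ∀ f₃ ∈ holCotForms₂ (↥(maximalRealSubfield L)) L (IsCMField.complexConj L) H (IsCMField.complexConj_ne_one L)
        (UnitaryGroup.complexConj_smul_infinitePlace L) (cmPlace L ι) 𝔣,
      P.ContainsFun f₃ →
      (∀ f ∈ N, ∀ (hf : MemLp (toQuotFun (adelicGroupData (↥(maximalRealSubfield L)) L (IsCMField.complexConj L) 2 H) f) 2 μ)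
          (h₃ : MemLp (toQuotFun (adelicGroupData (↥(maximalRealSubfield L)) L (IsCMField.complexConj L) 2 H) f₃) 2 μ),
        ∀ u : archLocal L 2 H (cmPlace L ι),
          ⟪(adelicGroupData (↥(maximalRealSubfield L)) L (IsCMField.complexConj L) 2 H).rightRegular μ
              (adelicSingle (↥(maximalRealSubfield L)) L (IsCMField.complexConj L) 2 H (IsCMField.complexConj_ne_one L)
                (UnitaryGroup.complexConj_smul_infinitePlace L) (cmPlace L ι) u)
              (MemLp.toLp (toQuotFun (adelicGroupData (↥(maximalRealSubfield L)) L (IsCMField.complexConj L) 2 H) f) hf),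
            MemLp.toLp (toQuotFun (adelicGroupData (↥(maximalRealSubfield L)) L (IsCMField.complexConj L) 2 H) f₃) h₃⟫_ℂ = 0) →
      f₃ = 0)
  (hadm : ∀ (L : Type) [Field L] [NumberField L] [IsCMField L] (ι : L →+* ℂ) (H : Matrix (Fin 2) (Fin 2) L)
    (dV : Fin 2 → L) (_hdV : ∀ i, IsCMField.complexConj L (dV i) = dV i) (_hdV0 : ∀ i, dV i ≠ 0)
    (t : L) (_ht : t ≠ 0) (g : GL (Fin 2) L),
    formCongr ((IsCMField.complexConj L : L ≃ₐ[↥(maximalRealSubfield L)] L) : L →+* L) g (t • H) = Matrix.diagonal dV →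
    (∃ T : GL (Fin 2) ℂ, formCongr (starRingEnd ℂ) T ((Matrix.diagonal dV).map ι) = Matrix.diagonal ![(1 : ℂ), -1]) →
    (∀ τ' : L →+* ℂ, InfinitePlace.mk τ' ≠ InfinitePlace.mk ι → ((Matrix.diagonal dV).map τ').PosDef) →
    4 ≤ Module.finrank ℚ L →
    ∀ (𝔣 : ConeFrame L H (cmPlace L ι))
      (μ : Measure (adelicGroupData (↥(maximalRealSubfield L)) L (IsCMField.complexConj L) 2 H).automorphicQuotient)
      [(adelicGroupData (↥(maximalRealSubfield L)) L (IsCMField.complexConj L) 2 H).IsAutomorphicMeasure μ]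
      (P : DiscreteAutomorphicRep (adelicGroupData (↥(maximalRealSubfield L)) L (IsCMField.complexConj L) 2 H) μ)
      (W : Type) [AddCommGroup W] [Module ℂ W]
      (σ : Representation ℂ (finAdelic (↥(maximalRealSubfield L)) L (IsCMField.complexConj L) 2 H) W),
      σ.IsIrreducible → σ.IsSmooth →
    ∀ ψ : W →ₗ[ℂ] ((adelicGroupData (↥(maximalRealSubfield L)) L (IsCMField.complexConj L) 2 H).Adelic → ℂ),
      (∀ (k : finAdelic (↥(maximalRealSubfield L)) L (IsCMField.complexConj L) 2 H) (w : W),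
          ψ (σ k w) = rightRep₂ (↥(maximalRealSubfield L)) L (IsCMField.complexConj L) H k (ψ w)) →
      (∀ w : W, ψ w ∈ holCotForms₂ (↥(maximalRealSubfield L)) L (IsCMField.complexConj L) H (IsCMField.complexConj_ne_one L)
          (UnitaryGroup.complexConj_smul_infinitePlace L) (cmPlace L ι) 𝔣 ∧ P.ContainsFun (ψ w)) →
      ψ ≠ 0 → σ.IsAdmissible)

include hα hβ in
/-- **`OrthVanish (hol)` from S2⁺₂ (`hα`) and S2β₂ (`hβ`)**: in the letter's CM frame, a non-zero `U(H)(𝔸_{L⁺,f})`-stable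
`N ≤ holCotForms₂` contained in `P` and `f₃ ∈ holCotForms₂` contained in `P` with `⟪[f],[f₃]⟫ = 0` for every `f ∈ N` force `f₃ = 0`.
[cite: BorelWallach2000, VII 3.2] [cite: BorelJacquet1979, §4.6] -/
theorem orthVanish₂_hol (L : Type) [Field L] [NumberField L] [IsCMField L] (ι : L →+* ℂ) (H : Matrix (Fin 2) (Fin 2) L)
    (dV : Fin 2 → L) (hdV : ∀ i, IsCMField.complexConj L (dV i) = dV i) (hdV0 : ∀ i, dV i ≠ 0)
    (t : L) (ht : t ≠ 0) (g : GL (Fin 2) L)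
    (hg : formCongr ((IsCMField.complexConj L : L ≃ₐ[↥(maximalRealSubfield L)] L) : L →+* L) g (t • H) = Matrix.diagonal dV)
    (hsig : ∃ T : GL (Fin 2) ℂ, formCongr (starRingEnd ℂ) T ((Matrix.diagonal dV).map ι) = Matrix.diagonal ![(1 : ℂ), -1])
    (hdef : ∀ τ' : L →+* ℂ, InfinitePlace.mk τ' ≠ InfinitePlace.mk ι → ((Matrix.diagonal dV).map τ').PosDef)
    (h4 : 4 ≤ Module.finrank ℚ L) (𝔣 : ConeFrame L H (cmPlace L ι))
    (μ : Measure (adelicGroupData (↥(maximalRealSubfield L)) L (IsCMField.complexConj L) 2 H).automorphicQuotient)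
    [(adelicGroupData (↥(maximalRealSubfield L)) L (IsCMField.complexConj L) 2 H).IsAutomorphicMeasure μ]
    (P : DiscreteAutomorphicRep (adelicGroupData (↥(maximalRealSubfield L)) L (IsCMField.complexConj L) 2 H) μ) :
    ∀ N : Submodule ℂ ((adelicGroupData (↥(maximalRealSubfield L)) L (IsCMField.complexConj L) 2 H).Adelic → ℂ),
      N ≤ holCotForms₂ (↥(maximalRealSubfield L)) L (IsCMField.complexConj L) H (IsCMField.complexConj_ne_one L)
          (UnitaryGroup.complexConj_smul_infinitePlace L) (cmPlace L ι) 𝔣 →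
      (∀ f ∈ N, P.ContainsFun f) →
      (∀ (k : finAdelic (↥(maximalRealSubfield L)) L (IsCMField.complexConj L) 2 H), ∀ f ∈ N,
          rightRep₂ (↥(maximalRealSubfield L)) L (IsCMField.complexConj L) H k f ∈ N) → N ≠ ⊥ →
      ∀ f₃ ∈ holCotForms₂ (↥(maximalRealSubfield L)) L (IsCMField.complexConj L) H (IsCMField.complexConj_ne_one L)
          (UnitaryGroup.complexConj_smul_infinitePlace L) (cmPlace L ι) 𝔣, P.ContainsFun f₃ →
      (∀ f ∈ N, ∀ (hf : MemLp (toQuotFun (adelicGroupData (↥(maximalRealSubfield L)) L (IsCMField.complexConj L) 2 H) f) 2 μ)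
          (h₃ : MemLp (toQuotFun (adelicGroupData (↥(maximalRealSubfield L)) L (IsCMField.complexConj L) 2 H) f₃) 2 μ),
        ⟪hf.toLp (toQuotFun (adelicGroupData (↥(maximalRealSubfield L)) L (IsCMField.complexConj L) 2 H) f),
          h₃.toLp (toQuotFun (adelicGroupData (↥(maximalRealSubfield L)) L (IsCMField.complexConj L) 2 H) f₃)⟫_ℂ = 0) →
      f₃ = 0 := by
  intro N hNA hNP hNst hN0 f₃ hf₃ hP₃ horth
  exact hβ L ι H dV hdV hdV0 t ht g hg hsig hdef h4 𝔣 μ P N hNA hNP hNst hN0 f₃ hf₃ hP₃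
    (fun f hf hfm h₃m u => hα L ι H dV hdV hdV0 t ht g hg hsig hdef h4 𝔣 μ f f₃ (hNA hf) hf₃ hfm h₃m (horth f hf hfm h₃m) u)

include hα hβ hadm in
/-- **HEAD (E₂-hol, three cuts): the BODY of the named fact ★ `UnitaryCurveForms.cohIsotypicLine₂_hol` (verbatim; `δ`-equal to the name) FROM S2⁺₂ (`hα`), S2β₂ (`hβ`) and S3₂ (`hadm`)** — S1 by ★
`F0P2aStubS1SesqSchur.stubS1_holds`; the shape a registered sub-line composes from its own three stubs. [cite: Liu2021, App. D Lem. D.2 (2)]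
[cite: BorelWallach2000, VI 4.11; VII 3.2] -/
theorem cohIsotypicLine₂_hol_of_three_cuts :
    ∀ (L : Type) [Field L] [NumberField L] [IsCMField L] (ι : L →+* ℂ) (H : Matrix (Fin 2) (Fin 2) L)
    (dV : Fin 2 → L) (_hdV : ∀ i, IsCMField.complexConj L (dV i) = dV i) (_hdV0 : ∀ i, dV i ≠ 0)
    (t : L) (_ht : t ≠ 0) (g : GL (Fin 2) L),
    formCongr ((IsCMField.complexConj L : L ≃ₐ[↥(maximalRealSubfield L)] L) : L →+* L) g (t • H) = Matrix.diagonal dV →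
    (∃ T : GL (Fin 2) ℂ, formCongr (starRingEnd ℂ) T ((Matrix.diagonal dV).map ι) = Matrix.diagonal ![(1 : ℂ), -1]) →
    (∀ τ' : L →+* ℂ, InfinitePlace.mk τ' ≠ InfinitePlace.mk ι → ((Matrix.diagonal dV).map τ').PosDef) →
    4 ≤ Module.finrank ℚ L →
    ∀ (𝔣 : ConeFrame L H (cmPlace L ι))
      (μ : Measure (adelicGroupData (↥(maximalRealSubfield L)) L (IsCMField.complexConj L) 2 H).automorphicQuotient)
      [(adelicGroupData (↥(maximalRealSubfield L)) L (IsCMField.complexConj L) 2 H).IsAutomorphicMeasure μ]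
      (W : Type) [AddCommGroup W] [Module ℂ W]
      (σ : Representation ℂ (finAdelic (↥(maximalRealSubfield L)) L (IsCMField.complexConj L) 2 H) W),
      σ.IsIrreducible → σ.IsSmooth →
    ∀ P : DiscreteAutomorphicRep (adelicGroupData (↥(maximalRealSubfield L)) L (IsCMField.complexConj L) 2 H) μ,
      ∃ ψ₀ : W →ₗ[ℂ] ((adelicGroupData (↥(maximalRealSubfield L)) L (IsCMField.complexConj L) 2 H).Adelic → ℂ),
        ∀ ψ : W →ₗ[ℂ] ((adelicGroupData (↥(maximalRealSubfield L)) L (IsCMField.complexConj L) 2 H).Adelic → ℂ),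
          (∀ (g : finAdelic (↥(maximalRealSubfield L)) L (IsCMField.complexConj L) 2 H) (w : W),
              ψ (σ g w) = rightRep₂ (↥(maximalRealSubfield L)) L (IsCMField.complexConj L) H g (ψ w)) →
          (∀ w : W, ψ w ∈ holCotForms₂ (↥(maximalRealSubfield L)) L (IsCMField.complexConj L) H (IsCMField.complexConj_ne_one L)
              (UnitaryGroup.complexConj_smul_infinitePlace L) (cmPlace L ι) 𝔣 ∧ P.ContainsFun (ψ w)) →
            ∃ r : ℂ, ψ = r • ψ₀ := by
  intro L _ _ _ ι H dV hdV hdV0 t ht g hg hsig hdef h4 𝔣 μ _ W _ _ σ hirr hsm P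
  by_cases hex : ∃ ψ₁ : W →ₗ[ℂ] ((adelicGroupData (↥(maximalRealSubfield L)) L (IsCMField.complexConj L) 2 H).Adelic → ℂ),
      (∀ (k : finAdelic (↥(maximalRealSubfield L)) L (IsCMField.complexConj L) 2 H) (w : W),
          ψ₁ (σ k w) = rightRep₂ (↥(maximalRealSubfield L)) L (IsCMField.complexConj L) H k (ψ₁ w)) ∧
      (∀ w : W, ψ₁ w ∈ holCotForms₂ (↥(maximalRealSubfield L)) L (IsCMField.complexConj L) H (IsCMField.complexConj_ne_one L)
          (UnitaryGroup.complexConj_smul_infinitePlace L) (cmPlace L ι) 𝔣 ∧ P.ContainsFun (ψ₁ w)) ∧ ψ₁ ≠ 0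
  · obtain ⟨ψ₁, hE₁, hV₁, hne⟩ := hex
    have hadm' : σ.IsAdmissible := hadm L ι H dV hdV hdV0 t ht g hg hsig hdef h4 𝔣 μ P W σ hirr hsm ψ₁ hE₁ hV₁ hne
    exact ⟨ψ₁, fun ψ hE hV => exists_eq_smul_of_orthVanish₂ P _ (fun f hf => leftInvariant_of_mem_holCotForms₂ hf)
      (orthVanish₂_hol hα hβ L ι H dV hdV hdV0 t ht g hg hsig hdef h4 𝔣 μ P) σ hirr hadm' ψ₁ ψ hE₁ hV₁ hne hE hV⟩
  · refine ⟨0, fun ψ hE hV => ⟨0, ?_⟩⟩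
    push Not at hex
    rw [hex ψ hE hV, smul_zero]

include hα hadm in
/-- **HEAD (E₂-hol, two cuts): the BODY of ★ `UnitaryCurveForms.cohIsotypicLine₂_hol` (verbatim) FROM S2⁺₂ (`hα`) and S3₂ (`hadm`) ALONE** — S2β₂ DISCHARGED
by ★ `E2Density.density₂_holds`. [cite: Liu2021, App. D Lem. D.2 (2)] [cite: BorelWallach2000, VI 4.11; VII 3.2] -/
theorem cohIsotypicLine₂_hol_of_cuts :
    ∀ (L : Type) [Field L] [NumberField L] [IsCMField L] (ι : L →+* ℂ) (H : Matrix (Fin 2) (Fin 2) L)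
    (dV : Fin 2 → L) (_hdV : ∀ i, IsCMField.complexConj L (dV i) = dV i) (_hdV0 : ∀ i, dV i ≠ 0)
    (t : L) (_ht : t ≠ 0) (g : GL (Fin 2) L),
    formCongr ((IsCMField.complexConj L : L ≃ₐ[↥(maximalRealSubfield L)] L) : L →+* L) g (t • H) = Matrix.diagonal dV →
    (∃ T : GL (Fin 2) ℂ, formCongr (starRingEnd ℂ) T ((Matrix.diagonal dV).map ι) = Matrix.diagonal ![(1 : ℂ), -1]) →
    (∀ τ' : L →+* ℂ, InfinitePlace.mk τ' ≠ InfinitePlace.mk ι → ((Matrix.diagonal dV).map τ').PosDef) →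
    4 ≤ Module.finrank ℚ L →
    ∀ (𝔣 : ConeFrame L H (cmPlace L ι))
      (μ : Measure (adelicGroupData (↥(maximalRealSubfield L)) L (IsCMField.complexConj L) 2 H).automorphicQuotient)
      [(adelicGroupData (↥(maximalRealSubfield L)) L (IsCMField.complexConj L) 2 H).IsAutomorphicMeasure μ]
      (W : Type) [AddCommGroup W] [Module ℂ W]
      (σ : Representation ℂ (finAdelic (↥(maximalRealSubfield L)) L (IsCMField.complexConj L) 2 H) W),
      σ.IsIrreducible → σ.IsSmooth →
    ∀ P : DiscreteAutomorphicRep (adelicGroupData (↥(maximalRealSubfield L)) L (IsCMField.complexConj L) 2 H) μ,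
      ∃ ψ₀ : W →ₗ[ℂ] ((adelicGroupData (↥(maximalRealSubfield L)) L (IsCMField.complexConj L) 2 H).Adelic → ℂ),
        ∀ ψ : W →ₗ[ℂ] ((adelicGroupData (↥(maximalRealSubfield L)) L (IsCMField.complexConj L) 2 H).Adelic → ℂ),
          (∀ (g : finAdelic (↥(maximalRealSubfield L)) L (IsCMField.complexConj L) 2 H) (w : W),
              ψ (σ g w) = rightRep₂ (↥(maximalRealSubfield L)) L (IsCMField.complexConj L) H g (ψ w)) →
          (∀ w : W, ψ w ∈ holCotForms₂ (↥(maximalRealSubfield L)) L (IsCMField.complexConj L) H (IsCMField.complexConj_ne_one L)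
              (UnitaryGroup.complexConj_smul_infinitePlace L) (cmPlace L ι) 𝔣 ∧ P.ContainsFun (ψ w)) →
            ∃ r : ℂ, ψ = r • ψ₀ :=
  cohIsotypicLine₂_hol_of_three_cuts hα density₂_holds hadm

include hα hadm in
/-- **HEAD (E₂-antihol, two cuts): the BODY of ★ `UnitaryCurveForms.cohIsotypicLine₂_antihol` (verbatim) FROM the same two cuts**, by A-p06's conjugation
transport ★ `UnitaryCurveForms.cohIsotypicLine₂_antihol_of_hol`. [cite: Liu2021, App. D Lem. D.2 (2)] [cite: BorelWallach2000, VII 2.10 and 3.2] -/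
theorem cohIsotypicLine₂_antihol_of_cuts :
    ∀ (L : Type) [Field L] [NumberField L] [IsCMField L] (ι : L →+* ℂ) (H : Matrix (Fin 2) (Fin 2) L)
    (dV : Fin 2 → L) (_hdV : ∀ i, IsCMField.complexConj L (dV i) = dV i) (_hdV0 : ∀ i, dV i ≠ 0)
    (t : L) (_ht : t ≠ 0) (g : GL (Fin 2) L),
    formCongr ((IsCMField.complexConj L : L ≃ₐ[↥(maximalRealSubfield L)] L) : L →+* L) g (t • H) = Matrix.diagonal dV →
    (∃ T : GL (Fin 2) ℂ, formCongr (starRingEnd ℂ) T ((Matrix.diagonal dV).map ι) = Matrix.diagonal ![(1 : ℂ), -1]) →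
    (∀ τ' : L →+* ℂ, InfinitePlace.mk τ' ≠ InfinitePlace.mk ι → ((Matrix.diagonal dV).map τ').PosDef) →
    4 ≤ Module.finrank ℚ L →
    ∀ (𝔣 : ConeFrame L H (cmPlace L ι))
      (μ : Measure (adelicGroupData (↥(maximalRealSubfield L)) L (IsCMField.complexConj L) 2 H).automorphicQuotient)
      [(adelicGroupData (↥(maximalRealSubfield L)) L (IsCMField.complexConj L) 2 H).IsAutomorphicMeasure μ]
      (W : Type) [AddCommGroup W] [Module ℂ W]
      (σ : Representation ℂ (finAdelic (↥(maximalRealSubfield L)) L (IsCMField.complexConj L) 2 H) W),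
      σ.IsIrreducible → σ.IsSmooth →
    ∀ P : DiscreteAutomorphicRep (adelicGroupData (↥(maximalRealSubfield L)) L (IsCMField.complexConj L) 2 H) μ,
      ∃ ψ₀ : W →ₗ[ℂ] ((adelicGroupData (↥(maximalRealSubfield L)) L (IsCMField.complexConj L) 2 H).Adelic → ℂ),
        ∀ ψ : W →ₗ[ℂ] ((adelicGroupData (↥(maximalRealSubfield L)) L (IsCMField.complexConj L) 2 H).Adelic → ℂ),
          (∀ (g : finAdelic (↥(maximalRealSubfield L)) L (IsCMField.complexConj L) 2 H) (w : W),
              ψ (σ g w) = rightRep₂ (↥(maximalRealSubfield L)) L (IsCMField.complexConj L) H g (ψ w)) →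
          (∀ w : W, ψ w ∈ (holCotForms₂ (↥(maximalRealSubfield L)) L (IsCMField.complexConj L) H (IsCMField.complexConj_ne_one L)
              (UnitaryGroup.complexConj_smul_infinitePlace L) (cmPlace L ι) 𝔣).map
                (conjFun₂ (↥(maximalRealSubfield L)) L (IsCMField.complexConj L) H) ∧
            P.ContainsFun (ψ w)) →
            ∃ r : ℂ, ψ = r • ψ₀ :=
  UnitaryCurveForms.cohIsotypicLine₂_antihol_of_hol (cohIsotypicLine₂_hol_of_cuts hα hadm)

end Heads

end Summit.HodgeConjecture.HodgeConjecture.Cruxes.HLiu418.E2OfCuts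

end
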